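import Literature.NumberTheory.Transcendental.PhilipponZeroEstimateRegular
import Mathlib.RingTheory.Ideal.KrullsHeightTheorem
import Mathlib.GroupTheory.CosetCover
import HarnessLib

/-!
# Philippon's zero estimate on `𝔾ₐ × 𝔾ₘ^n`: the chain of generic cuts (lossy Prop. 2.2)

Topic `Literature/NumberTheory/Transcendental`. Twelfth module of the inline discharge of
`Literature.NumberTheory.Transcendental.Philippon1986_GaGm`: the construction in D. Roy's proof
of Prop. 2.2 (Nesterenko–Philippon (eds.), LNM 1752, Ch. 11, pp. 202–204) of successive generic
members `Q₁, …, Q_r` of the linear system `span F` generating a special ideal, each a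
non-zero-divisor modulo the ideal cut out by the previous ones *at the relevant points of `G`*,
combined with the lossy Bézout bound of `…Hilbert.lean`. Setting: finitely many primes `𝔭ᵢ ∌ u`
of `B = ℂ[X, Y₁, …, Y_n]` (the top components in `Σ + H`), a finite `F ⊆ Box(1) ∩ ⋂ 𝔭ᵢ`, and the
dimension hypothesis "every prime `𝔭' ∌ u` containing `F` has height `≥ r`" (all components of
`Z(F) ∩ G` have codimension `≥ r`). PROVED:

* `exists_mem_forall_notMem_of_not_subset` — a subspace not contained in any of finitely many
  primes has an element outside all of them (`ℂ` is infinite; `Subspace.exists_eq_top_of_iUnion_eq_univ`);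
* `exists_list_avoids` — the generic sequence `Q₁, …, Q_r ∈ span F` with each `Q_{j+1}` outside
  the minimal primes `𝔭' ⊆ 𝔭ᵢ` of `(Q₁, …, Q_j)` (these have height `≤ j < r` by Krull's height
  theorem, so cannot contain `F`);
* **`exists_ideal_hilbI_le`** — an ideal `𝔍 ≤ loc 𝔭ᵢ (F)` for all `i` with
  `H_𝔍(t) ≤ 2^{(n+1)r} D₀D₁ⁿ (t+1)^{n+1-r}` for all `t` (`hilbI_chain_le` along
  `𝔍_j = ⋂ᵢ loc 𝔭ᵢ (Q₁, …, Q_j)`, the non-zero-divisor property coming from `isNZDMod_loc_ofList`,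
  i.e. from the Cohen–Macaulay property of the `B_{𝔭ᵢ}`).

## References

* Yu. V. Nesterenko, P. Philippon (eds.), *Introduction to Algebraic Independence Theory*,
  LNM 1752, Springer 2001, Ch. 11 (D. Roy), Prop. 2.2 (pp. 202–204), §2.2 (iii).
* P. Philippon, *Lemmes de zéros dans les groupes algébriques commutatifs*, Bull. Soc. Math.
  France 114 (1986), 355–383, Prop. 3.3.
-/

noncomputable section

open MvPolynomial Module

namespace Literature.NumberTheory.Transcendental

namespace GaGm

variable {n : ℕ} {D₀ D₁ : ℕ}

/-! ### Avoiding finitely many primes inside a subspace -/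

/-- A `ℂ`-subspace of `B` not contained in any of finitely many ideals `𝔭' ∈ 𝓑` has an element
outside all of them (a vector space over an infinite field is not a finite union of proper
subspaces). [folklore] -/
theorem exists_mem_forall_notMem_of_not_subset (V : Submodule ℂ (MvPolynomial (Fin (n + 1)) ℂ))
    {𝓑 : Set (Ideal (MvPolynomial (Fin (n + 1)) ℂ))} (h𝓑 : 𝓑.Finite)
    (h : ∀ 𝔭' ∈ 𝓑, ¬ ((V : Set (MvPolynomial (Fin (n + 1)) ℂ)) ⊆ 𝔭')) :
    ∃ Q ∈ V, ∀ 𝔭' ∈ 𝓑, Q ∉ 𝔭' := by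
  by_contra hcon
  push Not at hcon
  haveI : Finite ↥𝓑 := h𝓑.to_subtype
  let p : ↥𝓑 → Submodule ℂ ↥V := fun b => ((b.1 : Ideal _).restrictScalars ℂ).comap V.subtype
  have hcov : ⋃ b, (p b : Set ↥V) = Set.univ := by
    refine Set.eq_univ_of_forall fun v => ?_
    obtain ⟨𝔭', h𝔭', hv⟩ := hcon v v.2
    exact Set.mem_iUnion.mpr ⟨⟨𝔭', h𝔭'⟩, hv⟩
  obtain ⟨b, hb⟩ := Subspace.exists_eq_top_of_iUnion_eq_univ hcov
  refine h b.1 b.2 fun x hx => ?_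
  have : (⟨x, hx⟩ : ↥V) ∈ p b := by rw [hb]; trivial
  exact this

/-! ### The generic sequence -/

/-- Appending one element to a list: decompositions of `Qs ++ [Q]`. [folklore] -/
theorem append_singleton_eq_append_cons {α : Type*} {Qs L₁ L₂ : List α} {Q q : α}
    (h : Qs ++ [Q] = L₁ ++ q :: L₂) : (L₁ = Qs ∧ q = Q ∧ L₂ = []) ∨ ∃ L₂', Qs = L₁ ++ q :: L₂' := by
  rcases List.append_eq_append_iff.mp h with ⟨a', h1, h2⟩ | ⟨c', h1, h2⟩
  · -- `L₁ = Qs ++ a'`, `[Q] = a' ++ q :: L₂`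
    cases a' with
    | nil =>
      simp only [List.nil_append, List.cons.injEq, List.append_nil] at h1 h2
      obtain ⟨h3, h4⟩ := h2
      left
      exact ⟨by rw [h1], by rw [h3], by rw [← h4]⟩
    | cons x xs => simp at h2
  · -- `Qs = L₁ ++ c'`, `q :: L₂ = c' ++ [Q]`
    cases c' with
    | nil =>
      simp only [List.append_nil, List.nil_append, List.cons.injEq] at h1 h2
      obtain ⟨h3, h4⟩ := h2
      left
      exact ⟨by rw [h1], by rw [h3], by rw [h4]⟩
    | cons x xs =>
      simp only [List.cons_append, List.cons.injEq] at h2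
      obtain ⟨rfl, -⟩ := h2
      exact Or.inr ⟨xs, h1⟩

variable {ι : Type*} [Fintype ι] (𝔭 : ι → Ideal (MvPolynomial (Fin (n + 1)) ℂ)) (h𝔭 : ∀ i, (𝔭 i).IsPrime)
  (Fset : Finset (MvPolynomial (Fin (n + 1)) ℂ)) (r : ℕ)
  (hDH : ∀ 𝔭' : Ideal (MvPolynomial (Fin (n + 1)) ℂ), 𝔭'.IsPrime → (∃ i, 𝔭' ≤ 𝔭 i) →
    (↑Fset : Set (MvPolynomial (Fin (n + 1)) ℂ)) ⊆ 𝔭' → (r : ℕ∞) ≤ 𝔭'.height)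

omit [Fintype ι] in
include hDH in
/-- **The generic sequence**: `Q₁, …, Q_j ∈ span F` (`j ≤ r`) with each `Q_{l+1}` outside every
minimal prime `𝔭' ⊆ 𝔭ᵢ` of `(Q₁, …, Q_l)`. [cite: NesterenkoPhilippon2001, Ch. 11 Prop. 2.2 (proof)] -/
theorem exists_list_avoids : ∀ j ≤ r, ∃ Qs : List (MvPolynomial (Fin (n + 1)) ℂ), Qs.length = j ∧
    (∀ Q ∈ Qs, Q ∈ Submodule.span ℂ (↑Fset : Set (MvPolynomial (Fin (n + 1)) ℂ))) ∧
    ∀ i, AvoidsMinimalPrimesBelow (𝔭 i) Qs := by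
  intro j
  induction j with
  | zero =>
    intro _
    refine ⟨[], rfl, fun Q hQ => by simp at hQ, fun i L₁ q L₂ h => ?_⟩
    exact absurd h (by simp)
  | succ j ih =>
    intro hj
    obtain ⟨Qs, hlen, hspan, hav⟩ := ih (by omega)
    -- the bad primes: minimal primes of `(Qs)` below some `𝔭 i`
    set 𝓑 : Set (Ideal (MvPolynomial (Fin (n + 1)) ℂ)) :=
      {𝔭' | 𝔭' ∈ (Ideal.ofList Qs).minimalPrimes ∧ ∃ i, 𝔭' ≤ 𝔭 i} with h𝓑
    have h𝓑fin : 𝓑.Finite :=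
      (Ideal.finite_minimalPrimes_of_isNoetherianRing _ (Ideal.ofList Qs)).subset fun _ h => h.1
    have hnot : ∀ 𝔭' ∈ 𝓑, ¬ ((Submodule.span ℂ (↑Fset : Set (MvPolynomial (Fin (n + 1)) ℂ)) :
        Set (MvPolynomial (Fin (n + 1)) ℂ)) ⊆ 𝔭') := by
      rintro 𝔭' ⟨h𝔭'min, hi⟩ hsub
      have hF : (↑Fset : Set (MvPolynomial (Fin (n + 1)) ℂ)) ⊆ 𝔭' :=
        fun x hx => hsub (Submodule.subset_span hx)
      have h1 := hDH 𝔭' h𝔭'min.1.1 hi hF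
      -- Krull: `height 𝔭' ≤ #Qs = j < r`
      have h2 : 𝔭'.height ≤ ({x | x ∈ Qs} : Set _).ncard :=
        Ideal.height_le_card_of_mem_minimalPrimes_span (List.finite_toSet Qs) h𝔭'min
      have h3 : ({x | x ∈ Qs} : Set (MvPolynomial (Fin (n + 1)) ℂ)).ncard ≤ j := by
        rw [← hlen, show ({x | x ∈ Qs} : Set _) = ↑Qs.toFinset by ext; simp, Set.ncard_coe_finset]
        exact List.toFinset_card_le Qs
      have h4 : (r : ℕ∞) ≤ j := h1.trans (h2.trans (by exact_mod_cast h3))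
      have : r ≤ j := by exact_mod_cast h4
      omega
    obtain ⟨Q, hQ, hQavoid⟩ := exists_mem_forall_notMem_of_not_subset _ h𝓑fin hnot
    refine ⟨Qs ++ [Q], by simp [hlen], fun Q' hQ' => ?_, fun i L₁ q L₂ hdec 𝔭' h𝔭' hle => ?_⟩
    · rw [List.mem_append, List.mem_singleton] at hQ'
      rcases hQ' with h | rfl
      · exact hspan Q' h
      · exact hQ
    · rcases append_singleton_eq_append_cons hdec with ⟨rfl, rfl, rfl⟩ | ⟨L₂', hQs⟩
      · exact hQavoid 𝔭' ⟨h𝔭', i, hle⟩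
      · exact hav i L₁ q L₂' hQs 𝔭' h𝔭' hle

/-! ### The chain and its Hilbert functions -/

omit [Fintype ι] in
/-- `loc 𝔭 (0) = (0)` (`B` is a domain). [folklore] -/
theorem loc_bot (i : ι) : loc (𝔭 i) (h𝔭 i) ⊥ = ⊥ := by
  refine le_antisymm (fun f ⟨P, hP, hPf⟩ => ?_) bot_le
  rw [Ideal.mem_bot] at hPf ⊢
  exact (mul_eq_zero.mp hPf).resolve_left fun h => hP (h ▸ (𝔭 i).zero_mem)

include hDH in
/-- **The ideal of the generic complete intersection, localised at the `𝔭ᵢ`, and its lossy Bézout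
bound**: there is `𝔍` with `𝔍 ≤ loc 𝔭ᵢ (F)` for all `i` and
`H_𝔍(t) ≤ 2^{(n+1)r} D₀ D₁ⁿ (t+1)^{n+1-r}` for all `t`.
[cite: NesterenkoPhilippon2001, Ch. 11 Prop. 2.2 (lossy form)] -/
theorem exists_ideal_hilbI_le [Nonempty ι] (hD₀ : 1 ≤ D₀) (hD₁ : 1 ≤ D₁) (hr : r ≤ n + 1)
    (hFBox : (↑Fset : Set (MvPolynomial (Fin (n + 1)) ℂ)) ⊆ (Box (n := n) D₀ D₁ 1 : Set (MvPolynomial (Fin (n + 1)) ℂ)))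
    (hF𝔭 : ∀ i, (↑Fset : Set (MvPolynomial (Fin (n + 1)) ℂ)) ⊆ (𝔭 i : Set (MvPolynomial (Fin (n + 1)) ℂ))) :
    ∃ 𝔍 : Ideal (MvPolynomial (Fin (n + 1)) ℂ),
      (∀ i, 𝔍 ≤ loc (𝔭 i) (h𝔭 i) (Ideal.span (↑Fset : Set (MvPolynomial (Fin (n + 1)) ℂ)))) ∧
      ∀ t, hilbI (n := n) D₀ D₁ (𝔍.restrictScalars ℂ) t ≤ 2 ^ ((n + 1) * r) * (D₀ * D₁ ^ n) * (t + 1) ^ (n + 1 - r) := by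
  classical
  obtain ⟨Qs, hlen, hspan, hav⟩ := exists_list_avoids 𝔭 Fset r hDH r le_rfl
  -- basic inclusions
  have hspanBox : Submodule.span ℂ (↑Fset : Set (MvPolynomial (Fin (n + 1)) ℂ)) ≤ Box (n := n) D₀ D₁ 1 :=
    Submodule.span_le.mpr hFBox
  have hspan𝔭 : ∀ i, Submodule.span ℂ (↑Fset : Set (MvPolynomial (Fin (n + 1)) ℂ)) ≤ (𝔭 i).restrictScalars ℂ :=
    fun i => Submodule.span_le.mpr (hF𝔭 i)
  have hspanI : Submodule.span ℂ (↑Fset : Set (MvPolynomial (Fin (n + 1)) ℂ)) ≤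
      (Ideal.span (↑Fset : Set (MvPolynomial (Fin (n + 1)) ℂ))).restrictScalars ℂ :=
    Submodule.span_le.mpr fun x hx => Ideal.subset_span hx
  have hofList : ∀ L : List (MvPolynomial (Fin (n + 1)) ℂ), (∀ Q ∈ L, Q ∈ Qs) →
      ∀ i, Ideal.ofList L ≤ 𝔭 i := fun L hL i => by
    rw [Ideal.ofList, Ideal.span_le]
    intro Q hQ
    exact hspan𝔭 i (hspan Q (hL Q hQ))
  -- the chain
  let 𝔍 : ℕ → Ideal (MvPolynomial (Fin (n + 1)) ℂ) := fun j =>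
    Finset.univ.inf fun i => loc (𝔭 i) (h𝔭 i) (Ideal.ofList (Qs.take j))
  let Q : ℕ → MvPolynomial (Fin (n + 1)) ℂ := fun j => Qs.getD (j - 1) 0
  have hQmem : ∀ j < r, Q (j + 1) ∈ Qs := fun j hj => by
    simp only [Q, Nat.add_sub_cancel]
    rw [List.getD_eq_getElem _ _ (by omega)]
    exact List.getElem_mem _
  have hdec : ∀ j < r, Qs = Qs.take j ++ Q (j + 1) :: Qs.drop (j + 1) := fun j hj => by
    simp only [Q, Nat.add_sub_cancel]
    rw [List.getD_eq_getElem _ _ (by omega), ← List.drop_eq_getElem_cons (by omega), List.take_append_drop]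
  have h0 : 𝔍 0 = ⊥ := by
    show Finset.univ.inf (fun i => loc (𝔭 i) (h𝔭 i) (Ideal.ofList (Qs.take 0))) = ⊥
    simp only [List.take_zero, Ideal.ofList_nil, loc_bot 𝔭 h𝔭]
    exact Finset.inf_const Finset.univ_nonempty _
  have hne : ∀ j < r, 𝔍 j ≠ ⊤ := fun j hj htop => by
    obtain ⟨i⟩ := ‹Nonempty ι›
    have h1 : 𝔍 j ≤ 𝔭 i := (Finset.inf_le (Finset.mem_univ i)).trans
      (loc_le (h𝔭 i) (hofList _ (fun Q hQ => List.mem_of_mem_take hQ) i))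
    exact (h𝔭 i).ne_top (top_le_iff.mp (htop ▸ h1))
  have hQB : ∀ j < r, Q (j + 1) ∈ Box (n := n) D₀ D₁ 1 := fun j hj => hspanBox (hspan _ (hQmem j hj))
  have hQnzd : ∀ j < r, IsNZDMod (𝔍 j) (Q (j + 1)) := fun j hj =>
    isNZDMod_finsetInf _ _ fun i _ => by
      haveI := h𝔭 i
      exact isNZDMod_loc_ofList (𝔭 i) (fun q hq => hspan𝔭 i (hspan q hq)) (hav i) (hdec j hj)
  have hstep : ∀ j < r, 𝔍 j ⊔ Ideal.span {Q (j + 1)} ≤ 𝔍 (j + 1) := fun j hj => by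
    have htake : Qs.take (j + 1) = Qs.take j ++ [Q (j + 1)] := by
      simp only [Q, Nat.add_sub_cancel]
      rw [List.getD_eq_getElem _ _ (by omega), List.take_succ_eq_append_getElem (by omega)]
    refine Finset.le_inf fun i _ => sup_le ((Finset.inf_le (Finset.mem_univ i)).trans (loc_mono (h𝔭 i) ?_)) ?_
    · rw [htake, Ideal.ofList_append]; exact le_sup_left
    · rw [Ideal.span_singleton_le_iff_mem]
      refine le_loc (h𝔭 i) _ ?_
      rw [htake, Ideal.ofList_append, Ideal.ofList_singleton]
      exact Ideal.mem_sup_right (Ideal.mem_span_singleton_self _)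
  have hbound := hilbI_chain_le hD₀ hD₁ 𝔍 Q r h0 hne hQB hQnzd hstep r le_rfl hr
  refine ⟨𝔍 r, fun i => (Finset.inf_le (Finset.mem_univ i)).trans (loc_mono (h𝔭 i) ?_), hbound⟩
  rw [List.take_of_length_le (by omega), Ideal.ofList, Ideal.span_le]
  intro q hq
  exact hspanI (hspan q hq)

end GaGm

end Literature.NumberTheory.Transcendental
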